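/-
Copyright (c) 2026 the pub-hodgecm-mathlib formalisation cell (harness21).  Prover seat hodgecm-mathlib-R90-C131-p02 (g0) (R90-TF S4 hand lent to L1
by CHAIR VALVE WORD W4), Track B «K2-LIT», hLiu418 = `stmt-HodgeConjecture-24832`; K1-a♮ line lead K2E5-p16 (g8) WORD #11 (α)/(b) (sign at the real places).
THEOREMS ONLY (no `def`, no instance, no notation, no named-fact hypothesis, no `sorry`); lane `--supports stmt-HodgeConjecture-24832 --as helper`.
-/
import Summits.HodgeConjecture.HodgeConjecture.Theorems.K2LiuArchTwistedScalarBlockContinuation   -- ★ p863260 (3c-cont), `t > 0`: `etaTwo_conj`, letters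
import Summits.HodgeConjecture.HodgeConjecture.Theorems.K2LiuHermTwoXiEtaSymmetry                  -- ★ `xiTwo_eq_etaTwo_of_neg_posSemidef`
import HarnessLib

/-!
# Crux `HLiu418`, KIND 1 a♮ (K1a-3-arch), (3c-cont⁻): the twisted archimedean block of the scalar type at a NEGATIVE rank-one index
# `T = −a·diag(t,0)·aᴴ` (`t > 0`) is holomorphic on `{0 < re s}` — the sign twin of ★ p863260

Cell `hodgecm-mathlib`, crux item hLiu418 = `stmt-HodgeConjecture-24832` (helper lane, count-neutral).  At a real place where the CM datum makes the
corner index totally NEGATIVE (line lead WORD #11 (b)), the index of the twisted block is `T = −a·diag(t,0)·aᴴ ≤ 0`.  The chain of ★ p863260 runs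
with ★ `xiTwo_eq_etaTwo_of_neg_posSemidef` (`ξ(V,T;α,β) = 4π⁴e^{iπ(β−α)}Γ₂(α)⁻¹Γ₂(β)⁻¹·η(2V, π(−T); β, α)`, `re α > 1`, `re β > 3`) in place of the
semidefinite identity: the parameters SWAP, so the continued letter is `Γ(α−1)⁻¹J_{p,πt}(β, α)` along the K1 line `(α₀, β₀) = (1 − k/2, 1 + k/2)`
(★ ED. 3b), holomorphic on `{1 − N < re(1 + k/2 + s)} ⊇ {0 < re s}` once `−k/2 < N`.
* §1 **`twistedArchBlock_scalarType_continuation_neg`**: for `h ∈ U(J)`, `k : ℤ`, `‖det a‖ = 1`, `t > 0`, `N : ℕ` with `−k/2 < N`,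
  `∃ E, DifferentiableOn ℂ E {s | 0 < s.re} ∧ ∀ s, ½ < s.re → (twisted block at index −a·diag(t,0)·aᴴ)(s) = E s`.

HONEST LABEL: scalar `K_w`-type; closes no socket.  HC_CM is proved only modulo the 7 printed citations (2 remaining named inputs: hLiu418 =
`stmt-HodgeConjecture-24832`, h413 = `stmt-HodgeConjecture-24833`) until rung 0 closes.  REL ≠ ★ ≠ BUILT.

## References
* [Shimura1982] G. Shimura, *Confluent hypergeometric functions on tube domains*, Math. Ann. 260 (1982), (1.28), §3 Thm. 3.1, §4 Thm. 4.2.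
* [Shimura1997] G. Shimura, *Euler Products and Eisenstein Series*, CBMS 93 (1997), §16.4, §18.4–18.5.
-/

set_option autoImplicit false
set_option linter.dupNamespace false

noncomputable section

open Complex MeasureTheory Set Matrix Filter
open scoped ComplexOrder ComplexConjugate Topology

namespace Summit.HodgeConjecture.HodgeConjecture.Cruxes.HLiu418.K2LiuArchTwistedScalarBlockContinuationNeg

open Literature.NumberTheory.ModularForms.SiegelUpperHalfSpace (num denom moeb)
open Summit.HodgeConjecture.HodgeConjecture.Cruxes.HLiu418.K2LiuHermTwoGammaDefs
open Summit.HodgeConjecture.HodgeConjecture.Cruxes.HLiu418.K2LiuHermTwoEtaDefs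
open Summit.HodgeConjecture.HodgeConjecture.Cruxes.HLiu418.K2LiuHermTwoConfluentXiDefs
open Summit.HodgeConjecture.HodgeConjecture.Cruxes.HLiu418.K2LiuHermitianTubeCocycle
open Summit.HodgeConjecture.HodgeConjecture.Cruxes.HLiu418.K2LiuArchInducedTubeDefs
open Summit.HodgeConjecture.HodgeConjecture.Cruxes.HLiu418.K2LiuHermTwoEtaRankOneReduction
open Summit.HodgeConjecture.HodgeConjecture.Cruxes.HLiu418.K2LiuHermTwoEtaRankOneContinuation
open Summit.HodgeConjecture.HodgeConjecture.Cruxes.HLiu418.K2LiuHermTwoXiEtaIdentitySemidefinite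
open Summit.HodgeConjecture.HodgeConjecture.Cruxes.HLiu418.K2LiuHermTwoXiEtaSymmetry
open Summit.HodgeConjecture.HodgeConjecture.Cruxes.HLiu418.K2LiuHermTwoConfluentXiHolomorphy
open Summit.HodgeConjecture.HodgeConjecture.Cruxes.HLiu418.K2LiuArchTwistedIntertwiningScalarSection
open Summit.HodgeConjecture.HodgeConjecture.Cruxes.HLiu418.K2LiuLocalKernelArchPlaceFactor (differentiableOn_Gamma_two_mul)
open Summit.HodgeConjecture.HodgeConjecture.Cruxes.HLiu418.K2LiuArchTwistedScalarBlockContinuation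

/-! ## §1 The continuation at a negative rank-one index -/

/-- **(3c-cont⁻) THE TWISTED ARCHIMEDEAN BLOCK OF THE SCALAR TYPE AT A NEGATIVE RANK-ONE INDEX IS HOLOMORPHIC ON `{0 < re s}`.**  For `h ∈ U(J)`,
`k : ℤ`, `T = −a·diag(t,0)·aᴴ` (`‖det a‖ = 1`, `t > 0`) and `N : ℕ` with `−k/2 < N`: there is `E` holomorphic on `{0 < re s}` with
`∫ e(−τ(T·X)) f⁰_{s,k}(J n(X) h) dX = E(s)` for every `s` with `½ < re s` (★ (3c) value; ★ `xiTwo_eq_etaTwo_of_neg_posSemidef` swaps `(α, β)`;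
covariance ★ `etaTwo_conj`; ★ ED. 2; ★ ED. 3b along `(1 − k/2, 1 + k/2)`; identity theorem). [Shimura1982, (1.28), §4 Thm. 4.2; §3 Thm. 3.1] -/
theorem twistedArchBlock_scalarType_continuation_neg (k : ℤ) {h : Matrix (Fin 2 ⊕ Fin 2) (Fin 2 ⊕ Fin 2) ℂ}
    (hh : hᴴ * Matrix.J (Fin 2) ℂ * h = Matrix.J (Fin 2) ℂ) {a : Matrix (Fin 2) (Fin 2) ℂ} (hdet : ‖a.det‖ = 1) {t : ℝ} (ht : 0 < t)
    {N : ℕ} (hN : -(k : ℝ) / 2 < N) :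
    ∃ E : ℂ → ℂ, DifferentiableOn ℂ E {s : ℂ | 0 < s.re} ∧ ∀ s : ℂ, 1 / 2 < s.re →
      (∫ r : Fin 2 → Fin 2 → ℝ, cexp (-(2 * Real.pi * I) * ((-(a * hermTwo (t, 0, 0) * aᴴ)) * hermOfReal r).trace) *
        archScalarSection k s (Matrix.J (Fin 2) ℂ * fromBlocks 1 (hermOfReal r) 0 1 * h)) = E s := by
  -- names
  set T : Matrix (Fin 2) (Fin 2) ℂ := -(a * hermTwo (t, 0, 0) * aᴴ) with hTdef
  set Z : Matrix (Fin 2) (Fin 2) ℂ := moeb h (I • (1 : Matrix (Fin 2) (Fin 2) ℂ)) with hZ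
  set d : Matrix (Fin 2) (Fin 2) ℂ := denom h (I • (1 : Matrix (Fin 2) (Fin 2) ℂ)) with hd
  set U : Matrix (Fin 2) (Fin 2) ℂ := (2 : ℂ)⁻¹ • (Z + Zᴴ) with hU
  set V : Matrix (Fin 2) (Fin 2) ℂ := (2 * I)⁻¹ • (Z - Zᴴ) with hV
  have hδ0 : d.det ≠ 0 := (isUnit_det_denom hh posDef_im_I_smul_one).ne_zero
  have hδpos : 0 < ‖d.det‖ := norm_pos_iff.mpr hδ0
  have hδc : (((‖d.det‖ : ℝ)) : ℂ) ≠ 0 := by exact_mod_cast hδpos.ne'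
  have hVpos : V.PosDef := posDef_im_moeb hh posDef_im_I_smul_one
  have hTh : T.IsHermitian := (isHermitian_mul_mul_conjTranspose a (isHermitian_hermTwo _)).neg
  have hTnpsd : (-T).PosSemidef := by
    rw [hTdef, neg_neg]
    exact posSemidef_conj_rankOne a ht.le
  -- the weight `g′ = aᴴ (2V) a > 0` in coordinates
  have ha : a.det ≠ 0 := fun h0 => by rw [h0, norm_zero] at hdet; exact zero_ne_one hdet
  have haU : IsUnit a := (Matrix.isUnit_iff_isUnit_det a).mpr (Ne.isUnit ha)
  have h2V : ((2 : ℂ) • V).PosDef := by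
    have h := hVpos.smul (by norm_num : (0 : ℝ) < 2)
    rwa [show ((2 : ℝ) • V) = ((2 : ℂ) • V) by rw [← Complex.coe_smul]; norm_num] at h
  have hg' : (aᴴ * ((2 : ℂ) • V) * a).PosDef := by
    have := Matrix.IsUnit.posDef_star_left_conjugate_iff (x := (2 : ℂ) • V) haU
    rw [Matrix.star_eq_conjTranspose] at this
    exact this.mpr h2V
  obtain ⟨e, he⟩ : ∃ e : ℝ × ℂ × ℝ, hermTwo e = aᴴ * ((2 : ℂ) • V) * a := ⟨_, hermTwo_eq_of_isHermitian hg'.1⟩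
  obtain ⟨hp, hpq⟩ := (posDef_hermTwo_iff e).mp (he.symm ▸ hg')
  obtain ⟨p, w, q⟩ := e
  simp only at hp hpq he
  have hπt : 0 < Real.pi * t := by positivity
  -- the continuation of `Γ(β−1)⁻¹ J` along the K1 line
  obtain ⟨F, hFd, hF⟩ := exists_continuation_jIntegral_line hp hπt N (1 - k / 2) (1 + k / 2)
  -- the candidate `E`
  refine ⟨fun s => (d.det ^ (-k) * (((‖d.det‖ : ℝ)) : ℂ) ^ ((k : ℂ) - 2 * s - 2) * cexp ((2 * Real.pi * I) * (T * U).trace)) *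
      ((1 / 8 : ℂ) * ((((4 * Real.pi ^ 4 : ℝ)) : ℂ) * cexp ((Real.pi * I) * ((s + 1 - k / 2) - (s + 1 + k / 2))) *
        ((Real.pi : ℂ)⁻¹ * (Complex.Gamma (s + 1 + k / 2))⁻¹) *
        ((Real.pi : ℂ)⁻¹ * (Complex.Gamma (s + 1 - k / 2))⁻¹ * (Complex.Gamma (s + 1 - k / 2 - 1))⁻¹) *
        ((Real.pi : ℂ) / p * cexp (-((p * (Real.pi * t) : ℝ) : ℂ)) *
          ((1 / ((q - normSq w / p : ℝ) : ℂ)) ^ ((s + 1 - k / 2) + (s + 1 + k / 2) - 2) * Complex.Gamma (2 * s)) * F s))), ?_, ?_⟩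
  · -- holomorphy on `{0 < re s}`
    have hsub : {s : ℂ | 0 < s.re} ⊆ {s : ℂ | 1 - (N : ℝ) < ((1 + k / 2 : ℂ) + s).re} := by
      intro s hs
      simp only [mem_setOf_eq, add_re, one_re, div_ofNat_re, intCast_re] at hs ⊢
      linarith
    have hq0 : (1 / ((q - normSq w / p : ℝ) : ℂ)) ≠ 0 := by
      have : 0 < q - normSq w / p := by rw [sub_pos, div_lt_iff₀ hp]; linarith
      exact one_div_ne_zero (by exact_mod_cast this.ne')
    have hP : Differentiable ℂ (fun s : ℂ => d.det ^ (-k) * (((‖d.det‖ : ℝ)) : ℂ) ^ ((k : ℂ) - 2 * s - 2) *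
        cexp ((2 * Real.pi * I) * (T * U).trace)) := by
      refine ((differentiable_const _).mul fun s => ?_).mul (differentiable_const _)
      exact ((((differentiableAt_const _).sub ((differentiableAt_id).const_mul _)).sub_const _).const_cpow (Or.inl hδc))
    have hC : Differentiable ℂ (fun s : ℂ => (((4 * Real.pi ^ 4 : ℝ)) : ℂ) * cexp ((Real.pi * I) * ((s + 1 - k / 2) - (s + 1 + k / 2))) *
        ((Real.pi : ℂ)⁻¹ * (Complex.Gamma (s + 1 + k / 2))⁻¹) *
        ((Real.pi : ℂ)⁻¹ * (Complex.Gamma (s + 1 - k / 2))⁻¹ * (Complex.Gamma (s + 1 - k / 2 - 1))⁻¹)) := by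
      refine (((differentiable_const _).mul ?_).mul ?_).mul ?_
      · exact (((differentiable_const _).mul ((((differentiable_id).add_const _).sub_const _).sub
          (((differentiable_id).add_const _).add_const _)))).cexp
      · exact (differentiable_const _).mul (Complex.differentiable_one_div_Gamma.comp (((differentiable_id).add_const _).add_const _))
      · refine ((differentiable_const _).mul ?_).mul ?_
        · exact Complex.differentiable_one_div_Gamma.comp (((differentiable_id).add_const _).sub_const _)
        · exact Complex.differentiable_one_div_Gamma.comp ((((differentiable_id).add_const _).sub_const _).sub_const _)
    have hR : DifferentiableOn ℂ (fun s : ℂ => (Real.pi : ℂ) / p * cexp (-((p * (Real.pi * t) : ℝ) : ℂ)) *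
        ((1 / ((q - normSq w / p : ℝ) : ℂ)) ^ ((s + 1 - k / 2) + (s + 1 + k / 2) - 2) * Complex.Gamma (2 * s))) {s : ℂ | 0 < s.re} := by
      refine ((differentiableOn_const _).mul ?_)
      refine DifferentiableOn.mul (fun s _ => ?_) differentiableOn_Gamma_two_mul
      exact (((((differentiableAt_id).add_const _).sub_const _).add (((differentiableAt_id).add_const _).add_const _)).sub_const _
        |>.const_cpow (Or.inl hq0)).differentiableWithinAt
    exact hP.differentiableOn.mul (((differentiableOn_const _).mul (hC.differentiableOn.mul (hR.mul (hFd.mono hsub)))))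
  · -- the value on `{½ < re s}`: both sides are holomorphic there and agree for `re s ≫ 0`
    -- (i) the block as a function of `s`, via ★ (3c)
    have hB : ∀ s : ℂ, (∫ r : Fin 2 → Fin 2 → ℝ, cexp (-(2 * Real.pi * I) * (T * hermOfReal r).trace) *
        archScalarSection k s (Matrix.J (Fin 2) ℂ * fromBlocks 1 (hermOfReal r) 0 1 * h)) =
        (d.det ^ (-k) * (((‖d.det‖ : ℝ)) : ℂ) ^ ((k : ℂ) - 2 * s - 2) * cexp ((2 * Real.pi * I) * (T * U).trace)) *
          ((1 / 8 : ℂ) * xiTwo V T ((1 + k / 2) + s) ((1 - k / 2) + s)) := by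
      intro s
      rw [twistedArchIntertwining_archScalarSection_eq k s hh T, ← hZ, ← hd]
      rw [show (1 + (k : ℂ) / 2) + s = s + 1 + k / 2 by ring, show (1 - (k : ℂ) / 2) + s = s + 1 - k / 2 by ring]
    -- (ii) holomorphy of the block on the half-plane `{½ < re s}`
    have hPd : Differentiable ℂ (fun s : ℂ => d.det ^ (-k) * (((‖d.det‖ : ℝ)) : ℂ) ^ ((k : ℂ) - 2 * s - 2) *
        cexp ((2 * Real.pi * I) * (T * U).trace)) := by
      refine ((differentiable_const _).mul fun s => ?_).mul (differentiable_const _)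
      exact ((((differentiableAt_const _).sub ((differentiableAt_id).const_mul _)).sub_const _).const_cpow (Or.inl hδc))
    have hXi : DifferentiableOn ℂ (fun s : ℂ => xiTwo V T ((1 + k / 2) + s) ((1 - k / 2) + s)) {s : ℂ | 1 / 2 < s.re} := by
      refine (differentiableOn_xiTwo_diag hVpos hTh (1 + k / 2) (1 - k / 2)).mono fun s hs => ?_
      simp only [mem_setOf_eq, add_re, sub_re, one_re, div_ofNat_re, intCast_re, mul_re, re_ofNat, im_ofNat, zero_mul, sub_zero] at hs ⊢
      linarith
    have hBd : DifferentiableOn ℂ (fun s : ℂ => ∫ r : Fin 2 → Fin 2 → ℝ, cexp (-(2 * Real.pi * I) * (T * hermOfReal r).trace) *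
        archScalarSection k s (Matrix.J (Fin 2) ℂ * fromBlocks 1 (hermOfReal r) 0 1 * h)) {s : ℂ | 1 / 2 < s.re} := by
      have e : (fun s : ℂ => ∫ r : Fin 2 → Fin 2 → ℝ, cexp (-(2 * Real.pi * I) * (T * hermOfReal r).trace) *
          archScalarSection k s (Matrix.J (Fin 2) ℂ * fromBlocks 1 (hermOfReal r) 0 1 * h)) =
          fun s => (d.det ^ (-k) * (((‖d.det‖ : ℝ)) : ℂ) ^ ((k : ℂ) - 2 * s - 2) * cexp ((2 * Real.pi * I) * (T * U).trace)) *
            ((1 / 8 : ℂ) * xiTwo V T ((1 + k / 2) + s) ((1 - k / 2) + s)) := funext hB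
      rw [e]
      exact hPd.differentiableOn.mul ((differentiableOn_const _).mul hXi)
    -- (iii) the agreement for `re s > |k| + 3`
    have hagree : ∀ s : ℂ, (|(k : ℝ)| + 3) < s.re →
        (∫ r : Fin 2 → Fin 2 → ℝ, cexp (-(2 * Real.pi * I) * (T * hermOfReal r).trace) *
          archScalarSection k s (Matrix.J (Fin 2) ℂ * fromBlocks 1 (hermOfReal r) 0 1 * h)) =
        (d.det ^ (-k) * (((‖d.det‖ : ℝ)) : ℂ) ^ ((k : ℂ) - 2 * s - 2) * cexp ((2 * Real.pi * I) * (T * U).trace)) *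
          ((1 / 8 : ℂ) * ((((4 * Real.pi ^ 4 : ℝ)) : ℂ) * cexp ((Real.pi * I) * ((s + 1 - k / 2) - (s + 1 + k / 2))) *
            ((Real.pi : ℂ)⁻¹ * (Complex.Gamma (s + 1 + k / 2))⁻¹) *
            ((Real.pi : ℂ)⁻¹ * (Complex.Gamma (s + 1 - k / 2))⁻¹ * (Complex.Gamma (s + 1 - k / 2 - 1))⁻¹) *
            ((Real.pi : ℂ) / p * cexp (-((p * (Real.pi * t) : ℝ) : ℂ)) *
              ((1 / ((q - normSq w / p : ℝ) : ℂ)) ^ ((s + 1 - k / 2) + (s + 1 + k / 2) - 2) * Complex.Gamma (2 * s)) * F s))) := by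
      intro s hs
      have hk1 : -( |(k : ℝ)| ) ≤ (k : ℝ) ∧ (k : ℝ) ≤ |(k : ℝ)| := ⟨neg_abs_le _, le_abs_self _⟩
      have hα' : 1 < (s + 1 + (k : ℂ) / 2).re := by
        simp only [add_re, one_re, div_ofNat_re, intCast_re]; linarith [hk1.1]
      have hβ' : 3 < (s + 1 - (k : ℂ) / 2).re := by
        simp only [add_re, sub_re, one_re, div_ofNat_re, intCast_re]; linarith [hk1.2]
      have hαβ : 3 < ((s + 1 - (k : ℂ) / 2) + (s + 1 + (k : ℂ) / 2)).re := by
        simp only [add_re, sub_re, one_re, div_ofNat_re, intCast_re]; linarith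
      have hβline : 1 < ((1 + (k : ℂ) / 2) + s).re := by
        simp only [add_re, one_re, div_ofNat_re, intCast_re]; linarith [hk1.1]
      -- ξ → η (negative index: parameters swap), rotate the index, reduce
      rw [hB s, show (1 + (k : ℂ) / 2) + s = s + 1 + k / 2 by ring, show (1 - (k : ℂ) / 2) + s = s + 1 - k / 2 by ring,
        xiTwo_eq_etaTwo_of_neg_posSemidef hVpos hTnpsd hα' hβ', hTdef, neg_neg, pi_smul_conj_rankOne a t,
        etaTwo_conj (isHermitian_hermTwo _) hdet ((2 : ℂ) • V), ← he, etaTwo_rankOne_eq hp hpq hπt hα' hαβ]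
      -- the continued letter
      have hFs := hF s hβline
      rw [show (1 + (k : ℂ) / 2) + s - 1 = s + 1 + k / 2 - 1 by ring, show (1 - (k : ℂ) / 2) + s - 2 = s + 1 - k / 2 - 2 by ring,
        show (1 + (k : ℂ) / 2) + s - 2 = s + 1 + k / 2 - 2 by ring] at hFs
      rw [hFs]
      -- `Γ₂(β)⁻¹ = π⁻¹ Γ(β)⁻¹ Γ(β−1)⁻¹`, `Γ₂(α)⁻¹ = π⁻¹ Γ(α)⁻¹ Γ(α−1)⁻¹`, `β + α − 2 = 2s`
      rw [hermTwoGamma_def, hermTwoGamma_def, mul_inv, mul_inv, mul_inv, mul_inv,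
        show (s + 1 - (k : ℂ) / 2) + (s + 1 + (k : ℂ) / 2) - 2 = 2 * s by ring]
      ring
    -- (iv) identity theorem on the half-plane `{½ < re s}`
    have hUo : IsOpen {s : ℂ | 1 / 2 < s.re} := isOpen_lt continuous_const Complex.continuous_re
    have hUc : IsPreconnected {s : ℂ | 1 / 2 < s.re} := (convex_halfSpace_re_gt (1 / 2)).isPreconnected
    set z₀ : ℂ := (((|(k : ℝ)| + 4 : ℝ)) : ℂ) with hz₀
    have hz₀U : z₀ ∈ {s : ℂ | 1 / 2 < s.re} := by
      simp only [mem_setOf_eq, hz₀, ofReal_re]; linarith [abs_nonneg (k : ℝ)]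
    have hEd : DifferentiableOn ℂ (fun s => (d.det ^ (-k) * (((‖d.det‖ : ℝ)) : ℂ) ^ ((k : ℂ) - 2 * s - 2) * cexp ((2 * Real.pi * I) * (T * U).trace)) *
      ((1 / 8 : ℂ) * ((((4 * Real.pi ^ 4 : ℝ)) : ℂ) * cexp ((Real.pi * I) * ((s + 1 - k / 2) - (s + 1 + k / 2))) *
        ((Real.pi : ℂ)⁻¹ * (Complex.Gamma (s + 1 + k / 2))⁻¹) *
        ((Real.pi : ℂ)⁻¹ * (Complex.Gamma (s + 1 - k / 2))⁻¹ * (Complex.Gamma (s + 1 - k / 2 - 1))⁻¹) *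
        ((Real.pi : ℂ) / p * cexp (-((p * (Real.pi * t) : ℝ) : ℂ)) *
          ((1 / ((q - normSq w / p : ℝ) : ℂ)) ^ ((s + 1 - k / 2) + (s + 1 + k / 2) - 2) * Complex.Gamma (2 * s)) * F s)))) {s : ℂ | 1 / 2 < s.re} := by
      -- the candidate is holomorphic on `{0 < re}` (first bullet, re-derived) hence on `{½ < re}`
      have hsub : {s : ℂ | 1 / 2 < s.re} ⊆ {s : ℂ | 1 - (N : ℝ) < ((1 + k / 2 : ℂ) + s).re} := by
        intro s hs
        simp only [mem_setOf_eq, add_re, one_re, div_ofNat_re, intCast_re] at hs ⊢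
        linarith
      have hsub0 : {s : ℂ | 1 / 2 < s.re} ⊆ {s : ℂ | 0 < s.re} := fun s hs => by
        simp only [mem_setOf_eq] at hs ⊢; linarith
      have hq0 : (1 / ((q - normSq w / p : ℝ) : ℂ)) ≠ 0 := by
        have : 0 < q - normSq w / p := by rw [sub_pos, div_lt_iff₀ hp]; linarith
        exact one_div_ne_zero (by exact_mod_cast this.ne')
      have hC : Differentiable ℂ (fun s : ℂ => (((4 * Real.pi ^ 4 : ℝ)) : ℂ) * cexp ((Real.pi * I) * ((s + 1 - k / 2) - (s + 1 + k / 2))) *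
          ((Real.pi : ℂ)⁻¹ * (Complex.Gamma (s + 1 + k / 2))⁻¹) *
          ((Real.pi : ℂ)⁻¹ * (Complex.Gamma (s + 1 - k / 2))⁻¹ * (Complex.Gamma (s + 1 - k / 2 - 1))⁻¹)) := by
        refine (((differentiable_const _).mul ?_).mul ?_).mul ?_
        · exact (((differentiable_const _).mul ((((differentiable_id).add_const _).sub_const _).sub
            (((differentiable_id).add_const _).add_const _)))).cexp
        · exact (differentiable_const _).mul (Complex.differentiable_one_div_Gamma.comp (((differentiable_id).add_const _).add_const _))
        · refine ((differentiable_const _).mul ?_).mul ?_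
          · exact Complex.differentiable_one_div_Gamma.comp (((differentiable_id).add_const _).sub_const _)
          · exact Complex.differentiable_one_div_Gamma.comp ((((differentiable_id).add_const _).sub_const _).sub_const _)
      have hR : DifferentiableOn ℂ (fun s : ℂ => (Real.pi : ℂ) / p * cexp (-((p * (Real.pi * t) : ℝ) : ℂ)) *
          ((1 / ((q - normSq w / p : ℝ) : ℂ)) ^ ((s + 1 - k / 2) + (s + 1 + k / 2) - 2) * Complex.Gamma (2 * s))) {s : ℂ | 1 / 2 < s.re} := by
        refine ((differentiableOn_const _).mul ?_)
        refine DifferentiableOn.mul (fun s _ => ?_) (differentiableOn_Gamma_two_mul.mono hsub0)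
        exact (((((differentiableAt_id).add_const _).sub_const _).add (((differentiableAt_id).add_const _).add_const _)).sub_const _
          |>.const_cpow (Or.inl hq0)).differentiableWithinAt
      exact hPd.differentiableOn.mul (((differentiableOn_const _).mul (hC.differentiableOn.mul (hR.mul (hFd.mono hsub)))))
    have hev : (fun s : ℂ => ∫ r : Fin 2 → Fin 2 → ℝ, cexp (-(2 * Real.pi * I) * (T * hermOfReal r).trace) *
          archScalarSection k s (Matrix.J (Fin 2) ℂ * fromBlocks 1 (hermOfReal r) 0 1 * h)) =ᶠ[𝓝 z₀]
        (fun s => (d.det ^ (-k) * (((‖d.det‖ : ℝ)) : ℂ) ^ ((k : ℂ) - 2 * s - 2) * cexp ((2 * Real.pi * I) * (T * U).trace)) *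
          ((1 / 8 : ℂ) * ((((4 * Real.pi ^ 4 : ℝ)) : ℂ) * cexp ((Real.pi * I) * ((s + 1 - k / 2) - (s + 1 + k / 2))) *
            ((Real.pi : ℂ)⁻¹ * (Complex.Gamma (s + 1 + k / 2))⁻¹) *
            ((Real.pi : ℂ)⁻¹ * (Complex.Gamma (s + 1 - k / 2))⁻¹ * (Complex.Gamma (s + 1 - k / 2 - 1))⁻¹) *
            ((Real.pi : ℂ) / p * cexp (-((p * (Real.pi * t) : ℝ) : ℂ)) *
              ((1 / ((q - normSq w / p : ℝ) : ℂ)) ^ ((s + 1 - k / 2) + (s + 1 + k / 2) - 2) * Complex.Gamma (2 * s)) * F s)))) := by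
      have hopen : IsOpen {s : ℂ | (|(k : ℝ)| + 3) < s.re} := isOpen_lt continuous_const Complex.continuous_re
      have hmem : z₀ ∈ {s : ℂ | (|(k : ℝ)| + 3) < s.re} := by
        simp only [mem_setOf_eq, hz₀, ofReal_re]; linarith
      filter_upwards [hopen.mem_nhds hmem] with s hs
      exact hagree s hs
    intro s hs
    exact (hBd.analyticOnNhd hUo).eqOn_of_preconnected_of_eventuallyEq (hEd.analyticOnNhd hUo) hUc hz₀U hev hs

end Summit.HodgeConjecture.HodgeConjecture.Cruxes.HLiu418.K2LiuArchTwistedScalarBlockContinuationNeg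

end
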